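import Summits.HubbardSuperconductivity.HubbardSuperconductivity.Theorems.WidthHaldaneTubeThermalBloch
import Summits.HubbardSuperconductivity.HubbardSuperconductivity.Theorems.BalabanIRBirGappedPhaseReductionSectorFourier

/-!
# The canonical sector partition function of the tube in block form, and the thermal Bloch bound
# in the projector vocabulary of the helicity files

Support file for crux `WidthUniformThermodynamics` (stmt-HubbardSuperconductivity-16312; routes
`WidthHaldane`, `SeamInduction`). The helicity files of crux idea `euclidean-helicity-descent`
(`Theorems/WidthHaldaneTubeHelicityDescent.lean`, `…TubeHelicityCriterion.lean`) write the
canonical sector partition function in the PROJECTOR vocabulary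
`Z_β(θ) = re tr (P_{(2n, S^z=0)} e^{-β(H₀ + Tw_θ)})` (`P = projMatrix` of the transported
`szSector (2n) 0`, `e^{-βH} = Matrix.gibbsWeight`), while the thermal flux kinematics
(`Theorems/WidthHaldaneTubeThermalBloch.lean`, `Literature/…/HubbardTorusFluxThermalBlochBound`) are
written in the BLOCK vocabulary `Matrix.partitionFn (H.toBlock p p)`. This file proves that for
the sector-preserving tube Hamiltonians the two are THE SAME NUMBER and transports the thermal
Bloch bound (no definition, no named fact):

* `toBlock_pow_of_toBlock_compl_eq_zero`, **`toBlock_exp_of_toBlock_compl_eq_zero`**,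
  `toBlock_gibbsWeight_of_toBlock_compl_eq_zero` — GENERIC: a matrix with no entries from the
  block `p` to its complement has `(e^{A})_p = e^{A_p}` (the exponential series compressed term
  by term, `HasSum.map` + uniqueness of sums);
* `trace_indicator_mul_eq_trace_toBlock` — GENERIC: `tr (diag 𝟙_p · X) = tr X_p`;
* `tubeH_toBlock_compl_eq_zero`, `nonempty_sectorBlock` — the twisted tube has no entries from
  the occupation block `p_n s := (#↑s = n ∧ #↓s = n)` to its complement (`preservesSectors_tubeH`),
  and the block is non-empty for `n ≤ LM`;
* **`re_trace_proj_szSector_gibbsWeight_eq_partitionFn_toBlock`** — THE DICTIONARY: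
  `re tr (P_{(2n,0)} e^{-β(H₀+Tw_θ)}) = Re Z_β((H₀+Tw_θ)|_{p_n})`
  (`projMatrix_szSector_two_mul_zero_eq_diagonal` + the two generic facts);
* **`sectorFreeEnergy_tubeH_le`** / `sectorThermalBloch` (closed form, the registered sub-goal) —
  the thermal Bloch bound in the projector vocabulary: for `L ≥ 3`, `β > 0`, `n ≤ LM`,
  `F_β(θ) ≤ F_β(0) + θ²M/L` on the sector `(2n, S^z = 0)` — the thermal twin of
  `tubeEnergy_le_tubeEnergy_zero_add`, to be read next to the helicity descent
  `[F_β(θ₀) - F_β(0)] - β⁻¹ log (Z_β(0)e^{βE(0)}) ≤ E(θ₀) - E(0)` (`helicity_descent`).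

References: H. Tasaki, *Physics and Mathematics of Quantum Many-Body Systems* (2020) §2.1–2.2,
App. A.2; E. H. Lieb, PRL 62 (1989) 1201 (joint sectors); H. Watanabe, J. Stat. Phys. 177 (2019)
717, §2.2, §4.1; D. Bohm, Phys. Rev. 75 (1949) 502.
-/

noncomputable section

namespace Summit.HubbardSuperconductivity.HubbardSuperconductivity.Theorems.WidthHaldane

set_option linter.dupNamespace false -- summit = problem name (single-conjunct summit), D-0017

open scoped BigOperators Classical Matrix ComplexConjugate
open Matrix Literature.MathematicalPhysics.QuantumLattice

/-! ### Generic: compressions of block matrices commute with the exponential -/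

section BlockExp

variable {ι : Type*} [Fintype ι] [DecidableEq ι]

/-- Powers of a matrix with no entries from the block `p` to its complement compress to powers of
the compression: `(A^k)_p = (A_p)^k`. [folklore] -/
theorem toBlock_pow_of_toBlock_compl_eq_zero (A : Matrix ι ι ℂ) (p : ι → Prop) [DecidablePred p]
    (hA : A.toBlock p (fun a => ¬ p a) = 0) (k : ℕ) :
    (A ^ k).toBlock p p = (A.toBlock p p) ^ k := by
  induction k with
  | zero => rw [pow_zero, pow_zero, toBlock_one_self]
  | succ k ih => rw [pow_succ', toBlock_mul_eq_add p p p A (A ^ k), hA, Matrix.zero_mul, add_zero,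
      ih, pow_succ']

open NormedSpace in
open scoped Matrix.Norms.Operator in
/-- **The exponential of a matrix with no entries from the block `p` to its complement compresses to
the exponential of the compression**: `(e^{A})_p = e^{A_p}` (the exponential series term by term,
`toBlock_pow_of_toBlock_compl_eq_zero`). [folklore] -/
theorem toBlock_exp_of_toBlock_compl_eq_zero (A : Matrix ι ι ℂ) (p : ι → Prop) [DecidablePred p]
    (hA : A.toBlock p (fun a => ¬ p a) = 0) :
    (exp A).toBlock p p = exp (A.toBlock p p) := by
  have hs := exp_series_hasSum_exp' (𝕂 := ℂ) A
  let g : Matrix ι ι ℂ →+ Matrix {a // p a} {a // p a} ℂ :=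
    { toFun := fun X => X.toBlock p p, map_zero' := rfl, map_add' := fun _ _ => rfl }
  have hg : Continuous g := continuous_id.matrix_submatrix _ _
  have h1 : HasSum (fun k => ((k.factorial : ℂ)⁻¹ • A ^ k).toBlock p p) ((exp A).toBlock p p) :=
    hs.map g hg
  have h2 := exp_series_hasSum_exp' (𝕂 := ℂ) (A.toBlock p p)
  have heq : (fun k => ((k.factorial : ℂ)⁻¹ • A ^ k).toBlock p p) =
      fun k => (k.factorial : ℂ)⁻¹ • (A.toBlock p p) ^ k := by
    funext k
    rw [← toBlock_pow_of_toBlock_compl_eq_zero A p hA k]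
    rfl
  rw [heq] at h1
  exact h1.unique h2

/-- The Gibbs weight of a matrix with no entries from the block `p` to its complement compresses to
the Gibbs weight of the compression: `(e^{-βH})_p = e^{-βH_p}`. [folklore] -/
theorem toBlock_gibbsWeight_of_toBlock_compl_eq_zero (β : ℝ) (H : Matrix ι ι ℂ) (p : ι → Prop)
    [DecidablePred p] (hH : H.toBlock p (fun a => ¬ p a) = 0) :
    (gibbsWeight β H).toBlock p p = gibbsWeight β (H.toBlock p p) := by
  have hs : (-(β : ℂ) • H).toBlock p (fun a => ¬ p a) = 0 := by
    ext a b
    have h := congrFun (congrFun hH a) b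
    simp only [toBlock_apply, Matrix.zero_apply] at h
    simp only [toBlock_apply, Matrix.smul_apply, h, smul_zero, Matrix.zero_apply]
  rw [gibbsWeight, gibbsWeight, toBlock_exp_of_toBlock_compl_eq_zero _ p hs]
  rfl

omit [DecidableEq ι] in
/-- `tr (diag 𝟙_p · X) = tr X_p`: the trace against the coordinate projection of the block is the
trace of the compression. [folklore] -/
theorem trace_indicator_mul_eq_trace_toBlock {inst : DecidableEq ι} (p : ι → Prop) [DecidablePred p]
    (X : Matrix ι ι ℂ) :
    (@diagonal ι ℂ inst _ (fun a => if p a then (1 : ℂ) else 0) * X).trace = (X.toBlock p p).trace := by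
  simp only [Matrix.trace, Matrix.diag_apply, diagonal_mul, toBlock_apply]
  rw [sum_eq_sum_subtype_of_support p (fun a => (if p a then (1 : ℂ) else 0) * X a a)
    fun a ha => by rw [if_neg ha, zero_mul]]
  exact Finset.sum_congr rfl fun a _ => by rw [if_pos a.2, one_mul]

end BlockExp

/-! ### The dictionary: projector form `tr (P_K e^{-βH})` = block form `Z_β(H|_p)` -/

section Dictionary

variable (L M : ℕ) [NeZero L] [NeZero M] (Λ : Type) [LinearOrder Λ] [Fintype Λ]
  (e : Λ ≃ ZMod L × ZMod M)

/-- The twisted tube has no matrix entries from the occupation block `(#↑ = n, #↓ = n)` to its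
complement (it conserves `N↑` and `N↓`, `preservesSectors_tubeH`). [cite: LiebPRL1989, Remark (2)] -/
theorem tubeH_toBlock_compl_eq_zero (U θ : ℝ) (n : ℕ) :
    (tubeH0 L M Λ e U + tubeTwist L M Λ e θ).toBlock
        (fun s : Finset (Orb Λ) => (upPart s).card = n ∧ (downPart s).card = n)
        (fun s : Finset (Orb Λ) => ¬ ((upPart s).card = n ∧ (downPart s).card = n)) = 0 := by
  ext a b
  rw [toBlock_apply, Matrix.zero_apply]
  by_contra h
  have hs := preservesSectors_tubeH L M Λ e U θ a.1 b.1 h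
  exact b.2 ⟨hs.1.symm.trans a.2.1, hs.2.symm.trans a.2.2⟩

/-- The occupation block `(#↑ = n, #↓ = n)` of the `L × M` tube is non-empty for `n ≤ LM`.
[folklore] -/
theorem nonempty_sectorBlock (eΛ : Λ ≃ ZMod L × ZMod M) {n : ℕ} (hn : n ≤ L * M) :
    Nonempty {s : Finset (Orb Λ) // (upPart s).card = n ∧ (downPart s).card = n} := by
  have hcard : n ≤ Fintype.card Λ := by rwa [card_carrier L M Λ eΛ]
  obtain ⟨α₀, -, hα₀⟩ : ∃ α₀ : Finset Λ, α₀ ⊆ Finset.univ ∧ α₀.card = n :=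
    Finset.exists_subset_card_eq (by rwa [Finset.card_univ])
  exact ⟨⟨pairSet α₀ α₀, by rw [upPart_pairSet, hα₀], by rw [downPart_pairSet, hα₀]⟩⟩

/-- **THE DICTIONARY**: for the twisted tube and every `n`, the canonical partition function of the
sector `(2n, S^z = 0)` in the projector vocabulary of the helicity files,
`re tr (P_{(2n,0)} e^{-β(H₀ + Tw_θ)})` (`P = projMatrix` of the transported `szSector (2n) 0`,
`e^{-βH} = Matrix.gibbsWeight`), EQUALS the block partition function
`Re Z_β((H₀ + Tw_θ)|_{p_n})` of `Literature/…/HubbardTorusFluxThermalBlochBound`'s vocabulary,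
`p_n s := (#↑s = n ∧ #↓s = n)`: `P_{(2n,0)} = diag 𝟙_{p_n}`
(`projMatrix_szSector_two_mul_zero_eq_diagonal`) and `(e^{-βH})_{p_n} = e^{-βH_{p_n}}` for the
sector-preserving `H`. [folklore] -/
theorem re_trace_proj_szSector_gibbsWeight_eq_partitionFn_toBlock (U θ β : ℝ) (n : ℕ) :
    ((projMatrix ((szSector (Λ := Λ) (2 * n) 0).map
          ((WithLp.linearEquiv 2 ℂ (Finset (Orb Λ) → ℂ)).symm :
            (Finset (Orb Λ) → ℂ) →ₗ[ℂ] EuclideanSpace ℂ (Finset (Orb Λ)))) *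
        gibbsWeight β (tubeH0 L M Λ e U + tubeTwist L M Λ e θ)).trace).re =
      (partitionFn β ((tubeH0 L M Λ e U + tubeTwist L M Λ e θ).toBlock
        (fun s : Finset (Orb Λ) => (upPart s).card = n ∧ (downPart s).card = n)
        (fun s : Finset (Orb Λ) => (upPart s).card = n ∧ (downPart s).card = n))).re := by
  have hP : projMatrix ((szSector (Λ := Λ) (2 * n) 0).map
          ((WithLp.linearEquiv 2 ℂ (Finset (Orb Λ) → ℂ)).symm :
            (Finset (Orb Λ) → ℂ) →ₗ[ℂ] EuclideanSpace ℂ (Finset (Orb Λ)))) =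
      diagonal fun s : Finset (Orb Λ) =>
        if (upPart s).card = n ∧ (downPart s).card = n then (1 : ℂ) else 0 :=
    projMatrix_szSector_two_mul_zero_eq_diagonal (Λ := Λ) n
  rw [hP, trace_indicator_mul_eq_trace_toBlock (fun s : Finset (Orb Λ) => (upPart s).card = n ∧ (downPart s).card = n),
    toBlock_gibbsWeight_of_toBlock_compl_eq_zero β _ _ (tubeH_toBlock_compl_eq_zero L M Λ e U θ n), partitionFn]

/-- **Thermal Bloch bound in the projector vocabulary of the helicity files** (`L ≥ 3`, `β > 0`,
`n ≤ LM`): on the sector `(2n, S^z = 0)`,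
`F_β(θ) ≤ F_β(0) + θ²M/L`, `F_β(θ) = -β⁻¹ log re tr (P_{(2n,0)} e^{-β(H₀ + Tw_θ)})` — so the
helicity modulus read at any temperature obeys the same `O(M/L)` ceiling as the `T = 0` flux cost
(card `euclidean-helicity-descent`: its floor constant has `c ≤ 9/π²·…`-type a-priori bounds,
consistent with `tubeStiffness_le_two`). [cite: Watanabe2019, §2.2.3 and §4.1] -/
theorem sectorFreeEnergy_tubeH_le (hL : 3 ≤ L) (U θ : ℝ) {β : ℝ} (hβ : 0 < β) {n : ℕ}
    (hn : n ≤ L * M) :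
    -Real.log ((projMatrix ((szSector (Λ := Λ) (2 * n) 0).map
          ((WithLp.linearEquiv 2 ℂ (Finset (Orb Λ) → ℂ)).symm :
            (Finset (Orb Λ) → ℂ) →ₗ[ℂ] EuclideanSpace ℂ (Finset (Orb Λ)))) *
        gibbsWeight β (tubeH0 L M Λ e U + tubeTwist L M Λ e θ)).trace).re / β ≤
      -Real.log ((projMatrix ((szSector (Λ := Λ) (2 * n) 0).map
          ((WithLp.linearEquiv 2 ℂ (Finset (Orb Λ) → ℂ)).symm :
            (Finset (Orb Λ) → ℂ) →ₗ[ℂ] EuclideanSpace ℂ (Finset (Orb Λ)))) *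
        gibbsWeight β (tubeH0 L M Λ e U + tubeTwist L M Λ e 0)).trace).re / β + θ ^ 2 * M / L := by
  haveI := nonempty_sectorBlock L M Λ e hn
  rw [re_trace_proj_szSector_gibbsWeight_eq_partitionFn_toBlock L M Λ e U θ β n,
    re_trace_proj_szSector_gibbsWeight_eq_partitionFn_toBlock L M Λ e U 0 β n, tubeTwist_zero, add_zero]
  exact freeEnergy_toBlock_tubeH_le L M Λ e hL U θ hβ _

end Dictionary

/-- **THE THERMAL BLOCH BOUND IN THE PROJECTOR VOCABULARY, closed form** (the registered sub-goal
`sectorThermalBloch` of crux stmt-HubbardSuperconductivity-16312; all binders universally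
quantified): for every labelled tube with `L ≥ 3`, every `U`, `θ`, every `β > 0` and every
`n ≤ LM`, `F_β(θ) ≤ F_β(0) + θ²M/L` on the sector `(2n, S^z = 0)`,
`F_β(θ) = -β⁻¹ log re tr (P_{(2n,0)} e^{-β(H₀ + Tw_θ)})`. [cite: Watanabe2019, §2.2.3 and §4.1] -/
theorem sectorThermalBloch : ∀ (L M : ℕ) [NeZero L] [NeZero M] (Λ : Type) [LinearOrder Λ] [Fintype Λ] (e : Λ ≃ ZMod L × ZMod M) (U θ β : ℝ), 3 ≤ L → 0 < β → ∀ n : ℕ, n ≤ L * M → -Real.log ((projMatrix ((szSector (Λ := Λ) (2 * n) 0).map ((WithLp.linearEquiv 2 ℂ (Finset (Orb Λ) → ℂ)).symm : (Finset (Orb Λ) → ℂ) →ₗ[ℂ] EuclideanSpace ℂ (Finset (Orb Λ)))) * gibbsWeight β (tubeH0 L M Λ e U + tubeTwist L M Λ e θ)).trace).re / β ≤ -Real.log ((projMatrix ((szSector (Λ := Λ) (2 * n) 0).map ((WithLp.linearEquiv 2 ℂ (Finset (Orb Λ) → ℂ)).symm : (Finset (Orb Λ) → ℂ) →ₗ[ℂ]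 EuclideanSpace ℂ (Finset (Orb Λ)))) * gibbsWeight β (tubeH0 L M Λ e U + tubeTwist L M Λ e 0)).trace).re / β + θ ^ 2 * (M : ℝ) / (L : ℝ) :=
  fun L M _ _ Λ _ _ e U θ _β hL hβ _n hn => sectorFreeEnergy_tubeH_le L M Λ e hL U θ hβ hn

end Summit.HubbardSuperconductivity.HubbardSuperconductivity.Theorems.WidthHaldane

end
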